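import Summits.CriticalPhenomena.PercolationContinuityZ3.Theorems.SahiBoxTP2Affiliation
import Summits.CriticalPhenomena.PercolationContinuityZ3.Theorems.SahiBoxTP2HilbertMarginals

/-!
# Box-TP₂ ⟺ set-TP₂ ⟹ affiliated on the Hilbert cube `ℕ → [0,1]`

Support file of the Sahi cell (`prim-sahi`, typer seat, generation 12; `--supports stmt-CriticalPhenomena-4575`).
Infinite-dimensional companion of `SahiBoxTP2Affiliation.lean`: for every probability measure `μ` on `ℕ → [0,1]`,
box-TP₂ (⟺ all finite-dimensional marginals box-TP₂) implies Müller–Stoyan's set-TP₂ condition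
`μ(A) μ(B) ≤ μ(A ⊼ B) μ(A ⊻ B)` for ALL measurable `A, B` (`IsBoxTP2.mIsSetTP2_hilbert`), hence Milgrom–Weber
affiliation (`IsBoxTP2.mIsAffiliated_hilbert`).  Proof: for compact `A, B` project to the first `d` coordinates
(a lattice homomorphism, so `π_d(A ⊻ B) = π_d A ⊻ π_d B`), use the finite-dimensional theorem for the marginal, and
let `d → ∞`: the cylinders over `π_d(A ⊻ B)` decrease to `A ⊻ B` (`iInter_preimage_image_finRestrict`); then inner
regularity.  No sorries, no new axioms.
-/

noncomputable section

namespace Summit.CriticalPhenomena.PercolationContinuityZ3.Theorems.SahiBoxTP2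

open MeasureTheory ProbabilityTheory Set Filter Topology Function
open scoped ENNReal unitInterval SetFamily

section Hilbert

/-- The projection to the first `d` coordinates is continuous. [folklore] -/
theorem continuous_finRestrict (d : ℕ) : Continuous (finRestrict (X := I) d) :=
  continuous_pi fun i => continuous_apply (i : ℕ)

/-- The projection is a lattice homomorphism: it maps `A ⊻ B` onto `π A ⊻ π B`. [folklore] -/
theorem image_finRestrict_sups (d : ℕ) (A B : Set (ℕ → I)) :
    finRestrict d '' (A ⊻ B) = finRestrict d '' A ⊻ finRestrict d '' B := by
  rw [← Set.image_sup_prod, ← Set.image_sup_prod]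
  exact Set.image_image2_distrib fun _ _ => rfl

/-- … and `A ⊼ B` onto `π A ⊼ π B`. [folklore] -/
theorem image_finRestrict_infs (d : ℕ) (A B : Set (ℕ → I)) :
    finRestrict d '' (A ⊼ B) = finRestrict d '' A ⊼ finRestrict d '' B := by
  rw [← Set.image_inf_prod, ← Set.image_inf_prod]
  exact Set.image_image2_distrib fun _ _ => rfl

/-- **The cylinders over the projections of a closed set decrease to the set.** [folklore] -/
theorem iInter_preimage_image_finRestrict {K : Set (ℕ → I)} (hK : IsClosed K) :
    (⋂ d, finRestrict d ⁻¹' (finRestrict d '' K)) = K := by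
  refine Subset.antisymm (fun x hx => ?_) fun x hx => mem_iInter.2 fun d => ⟨x, hx, rfl⟩
  rw [mem_iInter] at hx
  choose k hk hkx using fun d => (hx d : finRestrict d x ∈ finRestrict d '' K)
  -- `k d → x`: coordinate `i` is eventually constant, equal to `x i`
  refine hK.mem_of_tendsto (b := atTop) (f := k) ?_ (Eventually.of_forall hk)
  rw [tendsto_pi_nhds]
  intro i
  refine tendsto_const_nhds.congr' ?_
  filter_upwards [eventually_gt_atTop i] with d hd
  have := congr_fun (hkx d) ⟨i, hd⟩
  simpa only [finRestrict_apply] using this.symm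

/-- The cylinders decrease with `d`. [folklore] -/
theorem antitone_preimage_image_finRestrict (K : Set (ℕ → I)) :
    Antitone fun d => finRestrict d ⁻¹' (finRestrict d '' K) := by
  intro d d' hdd' x hx
  obtain ⟨k, hk, hkx⟩ := hx
  refine ⟨k, hk, funext fun i => ?_⟩
  have := congr_fun hkx ⟨i, lt_of_lt_of_le i.2 hdd'⟩
  simpa only [finRestrict_apply] using this

/-- **Masses of the cylinders over the projections of a compact set converge to its mass.** [folklore] -/
theorem tendsto_measure_preimage_image_finRestrict (μ : Measure (ℕ → I)) [IsFiniteMeasure μ] {K : Set (ℕ → I)}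
    (hK : IsCompact K) :
    Tendsto (fun d => μ (finRestrict d ⁻¹' (finRestrict d '' K))) atTop (𝓝 (μ K)) := by
  have h := tendsto_measure_iInter_atTop (μ := μ)
    (fun d => (((hK.image (continuous_finRestrict d)).isClosed.measurableSet).preimage
      (measurable_finRestrict d)).nullMeasurableSet)
    (antitone_preimage_image_finRestrict K) ⟨0, measure_ne_top μ _⟩
  rwa [iInter_preimage_image_finRestrict hK.isClosed] at h

variable (μ : Measure (ℕ → I))

/-- **Set-TP₂ for compact sets on the Hilbert cube.** [this work] -/
theorem IsBoxTP2.measure_mul_le_of_isCompact_hilbert [IsProbabilityMeasure μ] (hμ : IsBoxTP2 μ) {A B : Set (ℕ → I)}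
    (hA : IsCompact A) (hB : IsCompact B) : μ A * μ B ≤ μ (A ⊼ B) * μ (A ⊻ B) := by
  have hAB₁ : IsCompact (A ⊼ B) := by
    rw [← Set.image_inf_prod, ← Set.image_uncurry_prod]
    exact (hA.prod hB).image (continuous_pi fun k =>
      ((continuous_apply k).comp continuous_fst).min ((continuous_apply k).comp continuous_snd))
  have hAB₂ : IsCompact (A ⊻ B) := by
    rw [← Set.image_sup_prod, ← Set.image_uncurry_prod]
    exact (hA.prod hB).image (continuous_pi fun k =>
      ((continuous_apply k).comp continuous_fst).max ((continuous_apply k).comp continuous_snd))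
  refine ge_of_tendsto' (ENNReal.Tendsto.mul (tendsto_measure_preimage_image_finRestrict μ hAB₁)
    (Or.inr (measure_ne_top μ _)) (tendsto_measure_preimage_image_finRestrict μ hAB₂) (Or.inr (measure_ne_top μ _)))
    fun d => ?_
  have hd : IsBoxTP2 (μ.map (finRestrict d)) := hμ.map_finRestrict_unitInterval d
  have key := hd.measure_mul_le_of_isClosed (μ.map (finRestrict d)) (hA.image (continuous_finRestrict d)).isClosed
    (hB.image (continuous_finRestrict d)).isClosed
  have hmeas : ∀ {C : Set (ℕ → I)}, IsCompact C → MeasurableSet (finRestrict d '' C) := fun hC =>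
    (hC.image (continuous_finRestrict d)).isClosed.measurableSet
  rw [← image_finRestrict_infs, ← image_finRestrict_sups, Measure.map_apply (measurable_finRestrict d) (hmeas hA),
    Measure.map_apply (measurable_finRestrict d) (hmeas hB), Measure.map_apply (measurable_finRestrict d) (hmeas hAB₁),
    Measure.map_apply (measurable_finRestrict d) (hmeas hAB₂)] at key
  exact (mul_le_mul' (measure_mono (Set.subset_preimage_image (finRestrict d) A))
    (measure_mono (Set.subset_preimage_image (finRestrict d) B))).trans key

/-- **BOX-TP₂ ⟹ SET-TP₂ on the Hilbert cube**: for every box-TP₂ probability measure on `ℕ → [0,1]` and all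
measurable `A, B`, `μ(A) μ(B) ≤ μ(A ⊼ B) μ(A ⊻ B)` (inner regularity by compact sets). [this work] -/
theorem IsBoxTP2.mIsSetTP2_hilbert [IsProbabilityMeasure μ] (hμ : IsBoxTP2 μ) :
    Literature.Probability.LatticeModels.Affiliation.mIsSetTP2 μ := by
  intro A B hA hB
  rw [hA.measure_eq_iSup_isCompact_of_ne_top (measure_ne_top μ A),
    hB.measure_eq_iSup_isCompact_of_ne_top (measure_ne_top μ B), ENNReal.iSup_mul]
  refine iSup_le fun K => ?_
  rw [ENNReal.iSup_mul]
  refine iSup_le fun hKA => ?_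
  rw [ENNReal.iSup_mul]
  refine iSup_le fun hK => ?_
  rw [ENNReal.mul_iSup]
  refine iSup_le fun L => ?_
  rw [ENNReal.mul_iSup]
  refine iSup_le fun hLB => ?_
  rw [ENNReal.mul_iSup]
  refine iSup_le fun hL => ?_
  exact (hμ.measure_mul_le_of_isCompact_hilbert μ hK hL).trans
    (mul_le_mul' (measure_mono (Set.infs_subset hKA hLB)) (measure_mono (Set.sups_subset hKA hLB)))

/-- **BOX-TP₂ ⟺ SET-TP₂ on the Hilbert cube.** [this work] -/
theorem isBoxTP2_iff_mIsSetTP2_hilbert [IsProbabilityMeasure μ] :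
    IsBoxTP2 μ ↔ Literature.Probability.LatticeModels.Affiliation.mIsSetTP2 μ :=
  ⟨fun hμ => hμ.mIsSetTP2_hilbert μ, fun h a b a' b' => h.icc a b a' b'⟩

/-- **BOX-TP₂ ⟹ AFFILIATED (Milgrom–Weber) on the Hilbert cube**: every conditional law of a box-TP₂ probability
measure on `ℕ → [0,1]` on a measurable sublattice is positively associated. [this work] -/
theorem IsBoxTP2.mIsAffiliated_hilbert [IsProbabilityMeasure μ] (hμ : IsBoxTP2 μ) :
    Literature.Probability.LatticeModels.Affiliation.mIsAffiliated μ :=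
  (hμ.mIsSetTP2_hilbert μ).mIsAffiliated

end Hilbert

end Summit.CriticalPhenomena.PercolationContinuityZ3.Theorems.SahiBoxTP2
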